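import Summits.QuantumFields.YangMills.Theorems.UnitScaleTiltProp7HSym
import Summits.QuantumFields.YangMills.Theorems.AlphaInputsT3ACv3OneBlockLiftMatrix
import HarnessLib

/-!
# Route `UnitScaleTilt`, crux K1 child «MinimiserStabilityRegPr» (stmt-QuantumFields-19200), skeleton v10 stub EX, route (α), node (AVG-SYM), MAP #3 row M12 (F) OF RECORD —
# **THE FLAT RIGHT INVERSE OF `QSym F n K h 1` FROM THE ONE-BLOCK KERNEL OF RECORD `obLiftL` (M18, `‖·‖ ≤ 1056∕L^{K−n}`)**: `Prop7HSym.exists_rightInv_QSym_one_of_lift` INSTANTIATED at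
# ★w3-19936 g3's matrix port `byEntry (obLiftL F K (K−n))` of ★alpha-2 g6's kernel (`OneBlockLiftMatrix.linAvgIterM_byEntry_obLiftL`, `norm_byEntry_obLiftL_le`, `byEntry_obLiftL_mem`)

Cell `ym3-torus`, width seat `ym-ust-19200-w2` (gen 2); ★★OWNER ym3-torus-plan g25 2026-08-28T03:46:59Z RULING M12 SHAPE «(F) APPROVED but NOT via `liftSM` (CS = 1.36·10⁸): use
★alpha-2's one-block kernel through ★w3-19936 g3's M18 matrix port (`obLiftM := byEntry (obLiftL F K (K−n))`, `linAvgIterM_obLiftM`, `‖·‖ ≤ 1056∕L^{K−n}`, 𝔰𝔲∕submodule row) +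
your `QSym_one_apply` junction».  YM₃ on T³ is ladder rung R3, not the Clay problem; nothing here is a claim about the crux, the stub, or a gap.  Count-neutral, def-free.

WHAT IS PROVED.  `three_le_pow_L` (`3 ≤ L^{K−n}` for `n < K`, `L` odd `> 1`); ★★ **`exists_rightInv_QSym_one_obLift (F) (hnK : n < K)`**: a `ℂ`-linear `H₁ : (PBond (F.P n) 0 → M₂) →ₗ[ℂ]
(PBond (F.P K) 0 → M₂)` with `QSym F n K hnK.le 1 (H₁ X) = X`, `‖H₁ X‖ ≤ (1056∕L^{K−n})·‖X‖` (sup → sup, un-rescaled tree bond fields), `S`-valued data ↦ `S`-valued fields for every real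
submodule `S ⊆ M₂(ℂ)`, and the formula `H₁ X = byEntry (obLiftL F K (K−n)) (X ∘ bondShift⁻¹)`; `exists_rightInv_QSym_one_352` — the k- and L-free majorant
`‖H₁ X‖ ≤ 352·‖X‖` (`1056∕L^{K−n} ≤ 352` since `L^{K−n} ≥ 3`).  HONEST SCOPE: the flat member only (`U₀ = 1`); the curved letter is `Prop7HSym.exists_rightInv_QSym_of_approx`
modulo the displayed covariant rows (T1)∕(T2).  Nothing continuum ∕ OS ∕ mass-gap ∕ Clay.

References: T. Bałaban, CMP **102** (1985) 277–309 [Balaban1985Variational] ((46)–(47) p.285); CMP **109** (1987) 249–301 [Balaban1987RG1] ((0.4), (0.11) p.253).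
-/

set_option autoImplicit false

noncomputable section

open scoped Matrix.Norms.L2Operator

namespace Summit.QuantumFields.YangMills.Theorems.Prop7HSymObLift

open Literature.MathematicalPhysics.QuantumFieldTheory.Balaban1983to89
open T3ContinuumYM3Torus
open T3LevelShift (bondShift)
open Summit.QuantumFields.YangMills.Theorems.LinearLiftMatrix (byEntry linAvgIterM)
open Summit.QuantumFields.YangMills.Theorems.AbelianEML.OneBlock (obLiftL)
open Summit.QuantumFields.YangMills.Theorems.OneBlockLiftMatrix (linAvgIterM_byEntry_obLiftL norm_byEntry_obLiftL_le byEntry_obLiftL_mem)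
open Summit.QuantumFields.YangMills.Theorems.Prop7SymAvgGL (QSym)
open Summit.QuantumFields.YangMills.Theorems.Prop7HSym (byEntry_add byEntry_smul_complex exists_rightInv_QSym_one_of_lift)

variable (F : T3Family) {n K : ℕ}

/-- `3 ≤ L^{K−n}` for `n < K` (the block size is odd and `> 1`, so `≥ 3`). [folklore] -/
theorem three_le_pow_L (hnK : n < K) : 3 ≤ F.L ^ (K - n) := by
  have hL3 : 3 ≤ F.L := by obtain ⟨a, ha⟩ := F.hL.1; have := F.hL.2; omega
  calc 3 ≤ F.L := hL3
    _ = F.L ^ 1 := (pow_one _).symm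
    _ ≤ F.L ^ (K - n) := Nat.pow_le_pow_right (by omega) (by omega)

/-- ★★ **(F) OF RECORD — THE FLAT RIGHT INVERSE OF THE SYMMETRIC LINEARISED AVERAGE FROM THE ONE-BLOCK KERNEL**: for `n < K` there is a `ℂ`-linear `H₁` from the route's coarse
data `PBond (F.P n) 0 → M₂` to finest bond fields with `QSym F n K _ 1 (H₁ X) = X`, the k-UNIFORM sup bound `‖H₁ X‖ ≤ (1056∕L^{K−n})‖X‖`, Lie-algebra-valued on Lie-algebra data, given by
`byEntry (obLiftL F K (K−n))` read through `bondShift` (`exists_rightInv_QSym_one_of_lift` at M18's rows). [cite: Balaban1985Variational, (46) p.285; Balaban1987RG1, (0.4)+(0.11) p.253] -/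
theorem exists_rightInv_QSym_one_obLift (hnK : n < K) :
    ∃ H₁ : (PBond (F.P n) 0 → Matrix (Fin 2) (Fin 2) ℂ) →ₗ[ℂ] (PBond (F.P K) 0 → Matrix (Fin 2) (Fin 2) ℂ),
      (∀ X, QSym F n K hnK.le 1 (H₁ X) = X) ∧
      (∀ X, ‖H₁ X‖ ≤ (1056 / (F.L : ℝ) ^ (K - n)) * ‖X‖) ∧
      (∀ (S : Submodule ℝ (Matrix (Fin 2) (Fin 2) ℂ)) (X : PBond (F.P n) 0 → Matrix (Fin 2) (Fin 2) ℂ), (∀ c, X c ∈ S) → ∀ b, H₁ X b ∈ S) ∧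
      (∀ X, H₁ X = byEntry (obLiftL F K (K - n))
        (fun c' => X ((bondShift (F.sitesPerDir_eq (m := F.m) (K := n) (j := 0) (m' := F.m) (K' := K) (j' := K - n) (by omega))).symm c'))) := by
  have hk : K - n ≤ K := Nat.sub_le K n
  have hn3 : 3 ≤ F.L ^ (K - n) := three_le_pow_L F hnK
  exact exists_rightInv_QSym_one_of_lift F hnK.le (fun A => byEntry (obLiftL F K (K - n)) A)
    (fun A B => byEntry_add (obLiftL F K (K - n)) A B) (fun z A => byEntry_smul_complex (obLiftL F K (K - n)) z A)
    (fun A => linAvgIterM_byEntry_obLiftL hk hn3 A) (by positivity)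
    (fun A M hA b => norm_byEntry_obLiftL_le hk hn3 A hA b) (fun S A hA b => byEntry_obLiftL_mem S hA b)

/-- ★ **THE k- AND L-FREE MAJORANT**: `1056∕L^{K−n} ≤ 352` (`L^{K−n} ≥ 3`), so `‖H₁ X‖ ≤ 352·‖X‖` — the shape `BH L` of the knit's (46) binder at the flat member.
[cite: Balaban1985Variational, (46) p.285] -/
theorem exists_rightInv_QSym_one_352 (hnK : n < K) :
    ∃ H₁ : (PBond (F.P n) 0 → Matrix (Fin 2) (Fin 2) ℂ) →ₗ[ℂ] (PBond (F.P K) 0 → Matrix (Fin 2) (Fin 2) ℂ),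
      (∀ X, QSym F n K hnK.le 1 (H₁ X) = X) ∧ (∀ X, ‖H₁ X‖ ≤ 352 * ‖X‖) ∧
      (∀ (S : Submodule ℝ (Matrix (Fin 2) (Fin 2) ℂ)) (X : PBond (F.P n) 0 → Matrix (Fin 2) (Fin 2) ℂ), (∀ c, X c ∈ S) → ∀ b, H₁ X b ∈ S) := by
  obtain ⟨H₁, hQ, hH, hmem, -⟩ := exists_rightInv_QSym_one_obLift F hnK
  have h3 : (3 : ℝ) ≤ (F.L : ℝ) ^ (K - n) := by exact_mod_cast three_le_pow_L F hnK
  have hρ : 1056 / (F.L : ℝ) ^ (K - n) ≤ 352 := by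
    rw [div_le_iff₀ (by positivity)]
    linarith
  exact ⟨H₁, hQ, fun X => (hH X).trans (mul_le_mul_of_nonneg_right hρ (norm_nonneg _)), hmem⟩

end Summit.QuantumFields.YangMills.Theorems.Prop7HSymObLift

end
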